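/-
Copyright: cell pub-balaban-gaps (YM BLITZ Y1, track G1), seat g1-p2 GEN 10 (unit `pub-balaban-gaps-g1-p2`).  Row (D4) NODE O,
OBJECT ∕ MECHANISM level: the row's first-missing-lemma SHAPE `ExistsUniformAcrossSmall` ((v)⁺) INHABITED ACROSS ANY FAMILY OF TORI from
PER-CUBE GAUGED DATA — GEN 5's `D4WalkModelAccretive.acrossSmall_accretive` took ONE GLOBAL conjugated coercivity of `Δ′(u) = 1 + K′(u)`;
here, for every member and every cube `□`, an invertible CUBE-CONJUGATOR pair `(G_□, G_□′)` (abstractly: mutually inverse, reducing the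
enlarged cube `□̃`, cube-local, row sums `≤ r_g′, r_g` — a site gauge `fibD u_□` is the instance, `D4WalkBlockLocalInverseGauge`), a BASE
coercivity of `compress (1 + K′₀) □̃` and a conjugated SCHUR budget of the remainder read in `□`'s conjugation `G_□Δ′(u)G_□′ − (1 + K′₀)` on
`□̃`: print's route Cor. 3.6 → Thm 3.7 → Thm 3.10 (p. 409) with (3.35)'s per-cube gauge as the only per-cube datum.  HONEST FRAMING: model ∕
mechanism; base coercivity (Thms 3.1–3.3) and the per-cube budgets ((3.35)–(3.37) on □) are hypothesis data; Bałaban's `Δ^{(k)}(𝐔)` NOT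
constructed; (D4) NOT discharged (instance 0∕1); NOT BetaPertH, NOT continuum, NOT Clay.
-/
import Summits.QuantumFields.BalabanUV.Gaps.D4WalkModelAccretive
import Summits.QuantumFields.BalabanUV.Gaps.D4WalkBlockLocalInverseGaugeEnd

/-!
# `Gaps.D4WalkModelGaugedSchur` — (v)⁺ across tori from per-cube conjugators, per-cube base coercivity and per-cube Schur budgets
# (cell pub-balaban-gaps, seat g1-p2 gen 10)

HONEST DEPENDENCY (cell pub-balaban, verbatim): continuum YM on T⁴ ⇐ BetaPertH ∧ nine spine estimates (0/9 proved);
BetaPertH ⇐ (D1) ∧ (D4) ∧ CAP+tail.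

Abstract carrier `n` (any member's sites × fibre).  A pair `(G, G′)` REDUCES `S` when `G i j ≠ 0 ⟹ (i ∈ S ↔ j ∈ S)` (and the same for
`G′`): block structure `S ⊕ Sᶜ` — a site gauge on a fibre-saturated `S` is the instance (103).
* §1 `compress_mul_of_reducing_left ∕ _right`, `compress_mul_compress_of_reducing`, `eq_extend_compress'`, **`extend_conj_of_reducing`**,
  **`locInv_conj_of_reducing`** (`extend((compress (G′MG) S)⁻¹) = G′·extend((compress M S)⁻¹)·G`), **`blockNorm_locInv_reducing_le`**
  (`× rr′` for cube-local `G, G′`), `differentiableOn_locInv_reducing`, `conj_conj_eq'`.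
* §2 **`gaugedCoercive_of_schur'`** (104 ∕ 105's per-cube coercivity from base + Schur budget, abstract conjugators).
* §3 **`acrossSmall_gaugedSchur`** = GEN 5's `acrossSmall_accretive` with `hcoer` REPLACED by per-cube conjugators + base + Schur budgets;
  `C_L = r_gr_g′·c_s∕(m − ½(c_r + c_c))`.
WHAT IT IS NOT.  Bałaban's family; (D4) instance 0∕1; words of row (D4) UNCHANGED.

References: T. Bałaban, Comm. Math. Phys. **99** (1985) 389–434 [B9], (3.35)–(3.37) p. 396, Thms 3.1–3.3 p. 399, Cor. 3.6 p. 408, Thm 3.7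
p. 409, Cor. 3.8 p. 410, Thm 3.10 p. 416; Comm. Math. Phys. **116** (1988) [II], (1.11) p. 5, p. 13, p. 15, (2.16) p. 16.
-/

noncomputable section

namespace Summit.QuantumFields.BalabanUV.Gaps.D4WalkModelGaugedSchur

open Metric Set Finset
open scoped Matrix
open Literature.MathematicalPhysics.QuantumFieldTheory.Balaban1983to89
open Literature.MathematicalPhysics.QuantumFieldTheory.Balaban1983to89.B9Thm34Ext (toB6)
open Literature.MathematicalPhysics.QuantumFieldTheory.Balaban1983to89.B9Thm37GlueTorus (torusGeom tdist1)
open Literature.MathematicalPhysics.QuantumFieldTheory.Balaban1983to89.B5TorusCover (UT)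
open Literature.MathematicalPhysics.QuantumFieldTheory.Balaban1983to89.B11SectG (RowSum)
open Literature.MathematicalPhysics.QuantumFieldTheory.Balaban1983to89.B5Prop11Lower (nsq)
open Literature.MathematicalPhysics.QuantumFieldTheory.Balaban1983to89.B13TermWalkDataOneTorus (ExistsUniformAcrossSmall)
open Summit.QuantumFields.BalabanUV.Gaps.D4WalkBlock (blockNorm blockNorm_nonneg)
open Summit.QuantumFields.BalabanUV.Gaps.D4WalkBlockConjugate (blockNorm_local_mul_le blockNorm_mul_local_le)
open Summit.QuantumFields.BalabanUV.Gaps.D4WalkModelParametrix (ParametrixModelMember acrossSmall_parametrix)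
open Summit.QuantumFields.BalabanUV.Gaps.D4WalkBlockCommutator (blockNorm_comm_le comm_blocks_subset)
open Summit.QuantumFields.BalabanUV.Gaps.D4WalkBlockLocalInverse (cRow cCol conjCoercive_uniform_of_schur)
open Summit.QuantumFields.BalabanUV.Gaps.D4WalkBlockLocalInverseGaugeEnd (blockNorm_locInvS_le differentiableOn_locInvS)
open Summit.QuantumFields.BalabanUV.Gaps.D4WalkBlockGaugeAlgebra (conj_inv_eq)
open Summit.QuantumFields.BalabanUV.Beta.UnitLatticeWalkInversion (Hd)
open Summit.QuantumFields.BalabanUV.Beta.UnitLatticeLocalInverse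
  (compress extend extend_apply_of_mem extend_apply_of_not_mem_left extend_apply_of_not_mem_right)
open Summit.QuantumFields.BalabanUV.Beta.AccretiveCombesThomas (conjForm)

/-! ## §1. Cube conjugators reducing `S`: compression ∕ extension ∕ local inverse -/

section Reducing

variable {n : Type} [Fintype n] [DecidableEq n] {S : Finset n} {G G' : Matrix n n ℂ}

omit [DecidableEq n] in
/-- compression passes a LEFT factor that reduces `S`. -/
theorem compress_mul_of_reducing_left (hG : ∀ i j, G i j ≠ 0 → (i ∈ S ↔ j ∈ S)) (M : Matrix n n ℂ) :
    compress (G * M) S = compress G S * compress M S := by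
  ext i j
  simp only [compress, Matrix.submatrix_apply, Matrix.mul_apply]
  rw [Finset.sum_coe_sort S (fun r => G i.1 r * M r j.1)]
  refine (Finset.sum_subset (Finset.subset_univ S) fun r _ hr => ?_).symm
  have : G i.1 r = 0 := by by_contra hne; exact hr ((hG _ _ hne).1 i.2)
  rw [this, zero_mul]

omit [DecidableEq n] in
/-- compression passes a RIGHT factor that reduces `S`. -/
theorem compress_mul_of_reducing_right (hG : ∀ i j, G i j ≠ 0 → (i ∈ S ↔ j ∈ S)) (M : Matrix n n ℂ) :
    compress (M * G) S = compress M S * compress G S := by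
  ext i j
  simp only [compress, Matrix.submatrix_apply, Matrix.mul_apply]
  rw [Finset.sum_coe_sort S (fun r => M i.1 r * G r j.1)]
  refine (Finset.sum_subset (Finset.subset_univ S) fun r _ hr => ?_).symm
  have : G r j.1 = 0 := by by_contra hne; exact hr ((hG _ _ hne).2 j.2)
  rw [this, mul_zero]

/-- `compress G S · compress G′ S = 1` when `GG′ = 1` and `G` reduces `S`. -/
theorem compress_mul_compress_of_reducing (hG : ∀ i j, G i j ≠ 0 → (i ∈ S ↔ j ∈ S)) (hGG' : G * G' = 1) :
    compress G S * compress G' S = 1 := by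
  rw [← compress_mul_of_reducing_left hG, hGG']
  ext i j
  simp only [compress, Matrix.submatrix_apply, Matrix.one_apply, Subtype.ext_iff]

omit [Fintype n] in
/-- a matrix supported in `S × S` is the extension of its compression. -/
theorem eq_extend_compress' {A : Matrix n n ℂ} (hrow : ∀ p, p ∉ S → ∀ q, A p q = 0) (hcol : ∀ q, q ∉ S → ∀ p, A p q = 0) :
    A = extend (compress A S) := by
  ext p q
  by_cases hp : p ∈ S
  · by_cases hq : q ∈ S
    · rw [extend_apply_of_mem _ hp hq]; rfl
    · rw [extend_apply_of_not_mem_right _ p hq, hcol q hq p]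
  · rw [extend_apply_of_not_mem_left _ hp, hrow p hp q]

/-- **`G′·extend N·G = extend (compress G′ S · N · compress G S)`** for conjugators reducing `S`. -/
theorem extend_conj_of_reducing (hG : ∀ i j, G i j ≠ 0 → (i ∈ S ↔ j ∈ S)) (hG' : ∀ i j, G' i j ≠ 0 → (i ∈ S ↔ j ∈ S))
    (N : Matrix S S ℂ) : G' * extend N * G = extend (compress G' S * N * compress G S) := by
  have hrow : ∀ p, p ∉ S → ∀ q, (G' * extend N * G) p q = 0 := by
    intro p hp q
    rw [Matrix.mul_apply]
    refine Finset.sum_eq_zero fun s _ => ?_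
    rw [Matrix.mul_apply, Finset.sum_eq_zero fun r _ => ?_, zero_mul]
    by_cases hr : r ∈ S
    · have : G' p r = 0 := by by_contra hne; exact hp ((hG' _ _ hne).2 hr)
      rw [this, zero_mul]
    · rw [extend_apply_of_not_mem_left _ hr, mul_zero]
  have hcol : ∀ q, q ∉ S → ∀ p, (G' * extend N * G) p q = 0 := by
    intro q hq p
    rw [Matrix.mul_apply]
    refine Finset.sum_eq_zero fun s _ => ?_
    by_cases hs : s ∈ S
    · have : G s q = 0 := by by_contra hne; exact hq ((hG _ _ hne).1 hs)
      rw [this, mul_zero]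
    · rw [Matrix.mul_apply, Finset.sum_eq_zero fun r _ => by rw [extend_apply_of_not_mem_right _ r hs, mul_zero], zero_mul]
  have hce : compress (extend N) S = N := by
    ext i j
    simp only [compress, Matrix.submatrix_apply]
    rw [extend_apply_of_mem _ i.2 j.2]
  calc G' * extend N * G = extend (compress (G' * extend N * G) S) := eq_extend_compress' hrow hcol
    _ = _ := by rw [compress_mul_of_reducing_right hG, compress_mul_of_reducing_left hG', hce]

/-- **THE LOCAL INVERSE CONJUGATES**: `extend((compress (G′·M·G) S)⁻¹) = G′·extend((compress M S)⁻¹)·G` for a mutually inverse pair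
reducing `S` — the local inverse at `□` may be computed in `□`'s own conjugation (gauge). [cite: Balaban1985BackgroundPropagators, (3.35) p.396, Cor. 3.6 p.408, p.409] -/
theorem locInv_conj_of_reducing (hG : ∀ i j, G i j ≠ 0 → (i ∈ S ↔ j ∈ S)) (hG' : ∀ i j, G' i j ≠ 0 → (i ∈ S ↔ j ∈ S))
    (hGG' : G * G' = 1) (hG'G : G' * G = 1) (M : Matrix n n ℂ) :
    extend ((compress (G' * M * G) S)⁻¹) = G' * extend ((compress M S)⁻¹) * G := by
  rw [compress_mul_of_reducing_right hG, compress_mul_of_reducing_left hG',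
    conj_inv_eq _ _ _ (compress_mul_compress_of_reducing hG' hG'G) (compress_mul_compress_of_reducing hG hGG'),
    extend_conj_of_reducing hG hG']

/-- `G′·(G·M·G′)·G = M`. -/
theorem conj_conj_eq' (hG'G : G' * G = 1) (M : Matrix n n ℂ) : G' * (G * M * G') * G = M := by
  simp only [← Matrix.mul_assoc]
  rw [hG'G, Matrix.one_mul, Matrix.mul_assoc, hG'G, Matrix.mul_one]

variable {ν : ℕ} {Kv : Fin ν → ℕ} (cubn : n → UT Kv)

/-- **BLOCK LETTER OF THE LOCAL INVERSE IN ITS CUBE'S CONJUGATION**: with `G, G′` also CUBE-LOCAL (vanishing across cubes) with row sums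
`≤ r′, r` and the conjugated compression `compress (G·A·G′) S` coercive `m` at rate `κ`, site row sum `c_s`:
`‖extend((compress A S)⁻¹)‖_{y,y′} ≤ rr′·c_s∕m`. [cite: Balaban1985BackgroundPropagators, (3.35) p.396, Cor. 3.6 p.408, (3.89) p.409] -/
theorem blockNorm_locInv_reducing_le (hG : ∀ i j, G i j ≠ 0 → (i ∈ S ↔ j ∈ S)) (hG' : ∀ i j, G' i j ≠ 0 → (i ∈ S ↔ j ∈ S))
    (hGG' : G * G' = 1) (hG'G : G' * G = 1) (hGloc : ∀ i j, cubn i ≠ cubn j → G i j = 0) (hG'loc : ∀ i j, cubn i ≠ cubn j → G' i j = 0)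
    {r r' : ℝ} (hr0 : 0 ≤ r) (hr0' : 0 ≤ r') (hr : ∀ i, ∑ j, ‖G' i j‖ ≤ r) (hr' : ∀ i, ∑ j, ‖G i j‖ ≤ r') (A : Matrix n n ℂ)
    (d : n → n → ℝ) (hd0 : ∀ j, d j j = 0) {κ m cs : ℝ} (hκ : 0 ≤ κ) (hm : 0 < m)
    (hc : ∀ j : S, ∀ z : S → ℂ, m * nsq z ≤ (conjForm (compress (G * A * G') S) κ (fun e : S => d e j) z).re)
    (hcs : 0 ≤ cs) (hsite : ∀ i, ∑ j, Real.exp (-(κ * d i j)) ≤ cs) (y y' : UT Kv) :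
    blockNorm cubn cubn (extend (compress A S)⁻¹) y y' ≤ r * r' * (cs / m) := by
  have e : extend (compress A S)⁻¹ = G' * extend (compress (G * A * G') S)⁻¹ * G := by
    have h := locInv_conj_of_reducing hG hG' hGG' hG'G (G * A * G')
    rwa [conj_conj_eq' hG'G] at h
  rw [e, Matrix.mul_assoc]
  calc _ ≤ r * blockNorm cubn cubn (extend (compress (G * A * G') S)⁻¹ * G) y y' :=
        blockNorm_local_mul_le cubn cubn G' hG'loc hr0 hr _ y y'
    _ ≤ r * (blockNorm cubn cubn (extend (compress (G * A * G') S)⁻¹) y y' * r') :=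
        mul_le_mul_of_nonneg_left (blockNorm_mul_local_le cubn cubn _ G hGloc hr0' hr' y y') hr0
    _ ≤ r * ((cs / m) * r') := mul_le_mul_of_nonneg_left (mul_le_mul_of_nonneg_right
        (blockNorm_locInvS_le cubn _ S d hd0 hκ hm hc hcs hsite y y') hr0') hr0
    _ = _ := by ring

variable {E : Type*} [NormedAddCommGroup E] [NormedSpace ℂ E]

/-- **HOLOMORPHY OF THE LOCAL INVERSE FROM ITS CUBE'S CONJUGATION**. [cite: Balaban1988RG2Cluster, p.15] -/
theorem differentiableOn_locInv_reducing (hG : ∀ i j, G i j ≠ 0 → (i ∈ S ↔ j ∈ S)) (hG' : ∀ i j, G' i j ≠ 0 → (i ∈ S ↔ j ∈ S))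
    (hGG' : G * G' = 1) (hG'G : G' * G = 1) {A : E → Matrix n n ℂ} {R : ℝ} (d : n → n → ℝ) {κ m : ℝ} (hm : 0 < m)
    (ha : ∀ i j, DifferentiableOn ℂ (fun u => A u i j) (ball (0 : E) R))
    (hc : ∀ u ∈ ball (0 : E) R, ∀ j : S, ∀ z : S → ℂ, m * nsq z ≤ (conjForm (compress (G * A u * G') S) κ (fun e : S => d e j) z).re)
    (i j : n) : DifferentiableOn ℂ (fun u => extend (compress (A u) S)⁻¹ i j) (ball (0 : E) R) := by
  have e : ∀ u, extend (compress (A u) S)⁻¹ = G' * extend (compress (G * A u * G') S)⁻¹ * G := fun u => by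
    have h := locInv_conj_of_reducing hG hG' hGG' hG'G (G * A u * G')
    rwa [conj_conj_eq' hG'G] at h
  have hcst : ∀ (M : Matrix n n ℂ) (a b : n), DifferentiableOn ℂ (fun _ : E => M a b) (ball (0 : E) R) :=
    fun M a b => differentiableOn_const _
  have hAg : ∀ k l, DifferentiableOn ℂ (fun u => (G * A u * G') k l) (ball (0 : E) R) := fun k l =>
    D4WalkProduct.differentiableOn_mul_entry (M₁ := fun u => G * A u) (M₂ := fun _ => G')
      (D4WalkProduct.differentiableOn_mul_entry (M₁ := fun _ => G) (M₂ := A) (hcst G) ha) (hcst G') k l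
  have hE := differentiableOn_locInvS (A := fun u => G * A u * G') S d hm hAg hc
  have hE' : DifferentiableOn ℂ (fun u => (G' * extend (compress (G * A u * G') S)⁻¹ * G) i j) (ball (0 : E) R) :=
    D4WalkProduct.differentiableOn_mul_entry (M₁ := fun u => G' * extend (compress (G * A u * G') S)⁻¹) (M₂ := fun _ => G)
      (D4WalkProduct.differentiableOn_mul_entry (M₁ := fun _ => G') (M₂ := fun u => extend (compress (G * A u * G') S)⁻¹)
        (hcst G') hE) (hcst G) i j
  exact hE'.congr fun u _ => congrFun (congrFun (e u) i) j

omit [Fintype n] [DecidableEq n] in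
/-- compression is additive. -/
theorem compress_sub' (M N : Matrix n n ℂ) (S : Finset n) : compress (M - N) S = compress M S - compress N S := rfl

omit [DecidableEq n] [NormedAddCommGroup E] [NormedSpace ℂ E] in
/-- **PER-CUBE COERCIVITY FROM BASE + SCHUR BUDGET IN THE CUBE'S CONJUGATION**: `G·A(u)·G′ = A_G(u)` on `B`, base coercivity `m` of
`compress A₀ S`, Schur sums `≤ c_r, c_c` of `compress (A_G(u) − A₀) S` on `B` ⟹ `compress (G·A(u)·G′) S` coercive `m − ½(c_r + c_c)` on `B`.
[cite: Balaban1985BackgroundPropagators, (3.35)–(3.37) p.396, Thms 3.1–3.3 p.399, Cor. 3.6 p.408] -/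
theorem gaugedCoercive_of_schur' {A Ag : E → Matrix n n ℂ} {B : Set E} (A₀ : Matrix n n ℂ) (hcov : ∀ u ∈ B, G * A u * G' = Ag u)
    (d : n → n → ℝ) {κ m cr cc : ℝ}
    (h0 : ∀ j : S, ∀ z : S → ℂ, m * nsq z ≤ (conjForm (compress A₀ S) κ (fun e : S => d e j) z).re)
    (hr : ∀ u ∈ B, ∀ (j : S) (e : S), cRow (compress (Ag u - A₀) S) κ (fun e : S => d e j) e ≤ cr)
    (hc : ∀ u ∈ B, ∀ (j : S) (e' : S), cCol (compress (Ag u - A₀) S) κ (fun e : S => d e j) e' ≤ cc) :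
    ∀ u ∈ B, ∀ j : S, ∀ z : S → ℂ,
      (m - (cr + cc) / 2) * nsq z ≤ (conjForm (compress (G * A u * G') S) κ (fun e : S => d e j) z).re := by
  intro u hu j z
  rw [hcov u hu]
  exact conjCoercive_uniform_of_schur (A := fun u => compress (Ag u) S) (S := B) (compress A₀ S) (fun e j : S => d e j) h0
    (fun u hu j e => by rw [← compress_sub']; exact hr u hu j e) (fun u hu j e' => by rw [← compress_sub']; exact hc u hu j e')
    u hu j z

end Reducing

/-! ## §2. (v)⁺ across tori from per-cube conjugators, base coercivity and Schur budgets -/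

variable {d : ℕ} {c : B13.Consts}

/-- **(v)⁺ ACROSS A FAMILY OF TORI FROM PER-CUBE GAUGED DATA** — GEN 5's `acrossSmall_accretive` with the GLOBAL conjugated coercivity
of `1 + K′(u)` REPLACED by: for every member and cube `□`, a mutually inverse conjugator pair `(G_□, G_□′)` reducing `□̃`, cube-local, with
row sums `≤ r_g′, r_g`; the operator in `□`'s conjugation `G_□(1 + K′(u))G_□′ = 1 + K′_□(u)` on the ball; base coercivity `m` of
`compress (1 + K′₀) □̃`; Schur sums `≤ c_r, c_c` of `compress (K′_□(u) − K′₀) □̃`; `m − ½(c_r + c_c) > 0`.  Every other letter as in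
`acrossSmall_accretive`; `C_L = r_gr_g′·c_s∕(m − ½(c_r + c_c))`. [cite: Balaban1985BackgroundPropagators, (3.35) p.396, Thms 3.1–3.3 (3.42) p.399, Cor 3.6 p.408, Thm 3.7 p.409, Cor 3.8 p.410, Thm 3.10 p.416; Balaban1988RG2Cluster, (1.11) p.5, p.13, p.15, (2.16) p.16] -/
theorem acrossSmall_gaugedSchur {S : Type*} (𝓜 : S → ParametrixModelMember d)
    (ds : ∀ s (i : (𝓜 s).ι), ((𝓜 s).t i).n → ((𝓜 s).t i).n → ℝ)
    (Gc Gc' : ∀ s (i : (𝓜 s).ι), ((𝓜 s).t i).L.B → Matrix ((𝓜 s).t i).n ((𝓜 s).t i).n ℂ)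
    (Kg : ∀ s (i : (𝓜 s).ι), ((𝓜 s).t i).L.B → (𝓜 s).E → Matrix ((𝓜 s).t i).n ((𝓜 s).t i).n ℂ)
    (K₀ : ∀ s (i : (𝓜 s).ι), Matrix ((𝓜 s).t i).n ((𝓜 s).t i).n ℂ)
    {R CK M m κc cs cr cc r₁ r rg rg' : ℝ} {mJ nD nC : ℕ} {ρ₀ ε₀ κ₀ μ cμ Rσ₀ α θ₀ : ℝ}
    (hop : ∀ s (i : (𝓜 s).ι) b u,
      ((𝓜 s).t i).L.op b u = extend (compress (1 + ((𝓜 s).t i).K' u) (((𝓜 s).t i).Es b))⁻¹)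
    (hanchor : ∀ s (i : (𝓜 s).ι) b, ((𝓜 s).t i).L.anchor b ∈ ((𝓜 s).t i).L.dom b)
    (hdiam : ∀ s (i : (𝓜 s).ι) b, ∀ z ∈ ((𝓜 s).t i).L.dom b, ∀ z' ∈ ((𝓜 s).t i).L.dom b, tdist1 (𝓜 s).K z z' ≤ r)
    (hJ : ∀ s (i : (𝓜 s).ι) b, (((𝓜 s).t i).L.J b).card ≤ mJ)
    (hX : ∀ s (i : (𝓜 s).ι) b, (((𝓜 s).t i).L.J b).Nonempty → (((𝓜 s).t i).L.dom b ∩ ((𝓜 s).t i).X).Nonempty)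
    (hmult : ∀ s (i : (𝓜 s).ι) (z : UT (𝓜 s).K), (Finset.univ.filter fun b => ((𝓜 s).t i).L.anchor b = z).card ≤ nD)
    (hcard : ∀ s (i : (𝓜 s).ι) b, (((𝓜 s).t i).L.dom b).card ≤ nC)
    (hsupp : ∀ s (i : (𝓜 s).ι) b y, y ∉ ((𝓜 s).t i).Es b → ((𝓜 s).t i).h b y = 0)
    (habs : ∀ s (i : (𝓜 s).ι) b y, |((𝓜 s).t i).h b y| ≤ 1)
    (hE : ∀ s (i : (𝓜 s).ι) b y, y ∈ ((𝓜 s).t i).Es b → ((𝓜 s).t i).cubn y ∈ ((𝓜 s).t i).L.dom b)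
    (hLip : ∀ s (i : (𝓜 s).ι) b k l, |((𝓜 s).t i).h b k - ((𝓜 s).t i).h b l| ≤ ds s i k l / M)
    (hdomE : ∀ s (i : (𝓜 s).ι) b k, (∃ l ∈ ((𝓜 s).t i).Es b, ds s i k l ≤ r₁) → ((𝓜 s).t i).cubn k ∈ ((𝓜 s).t i).L.dom b)
    (hsymm : ∀ s (i : (𝓜 s).ι) k l, ds s i k l = ds s i l k) (hd0 : ∀ s (i : (𝓜 s).ι) l, ds s i l l = 0)
    (hKan : ∀ s (i : (𝓜 s).ι) k l, DifferentiableOn ℂ (fun u => ((𝓜 s).t i).K' u k l) (ball (0 : (𝓜 s).E) R))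
    (hKbd : ∀ s (i : (𝓜 s).ι), ∀ u ∈ ball (0 : (𝓜 s).E) R, ∀ y y',
      blockNorm ((𝓜 s).t i).cubn ((𝓜 s).t i).cubn (((𝓜 s).t i).K' u) y y' ≤ CK)
    (hKrange : ∀ s (i : (𝓜 s).ι) u k l, ((𝓜 s).t i).K' u k l ≠ 0 → ds s i k l ≤ r₁)
    -- per-cube conjugators (gauges), base coercivity, Schur budgets
    (hGred : ∀ s (i : (𝓜 s).ι) b k l, Gc s i b k l ≠ 0 → (k ∈ ((𝓜 s).t i).Es b ↔ l ∈ ((𝓜 s).t i).Es b))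
    (hG'red : ∀ s (i : (𝓜 s).ι) b k l, Gc' s i b k l ≠ 0 → (k ∈ ((𝓜 s).t i).Es b ↔ l ∈ ((𝓜 s).t i).Es b))
    (hGG' : ∀ s (i : (𝓜 s).ι) b, Gc s i b * Gc' s i b = 1) (hG'G : ∀ s (i : (𝓜 s).ι) b, Gc' s i b * Gc s i b = 1)
    (hGloc : ∀ s (i : (𝓜 s).ι) b k l, ((𝓜 s).t i).cubn k ≠ ((𝓜 s).t i).cubn l → Gc s i b k l = 0)
    (hG'loc : ∀ s (i : (𝓜 s).ι) b k l, ((𝓜 s).t i).cubn k ≠ ((𝓜 s).t i).cubn l → Gc' s i b k l = 0)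
    (hrg0 : 0 ≤ rg) (hrg0' : 0 ≤ rg')
    (hrg : ∀ s (i : (𝓜 s).ι) b k, ∑ l, ‖Gc' s i b k l‖ ≤ rg) (hrg' : ∀ s (i : (𝓜 s).ι) b k, ∑ l, ‖Gc s i b k l‖ ≤ rg')
    (hcov : ∀ s (i : (𝓜 s).ι) b, ∀ u ∈ ball (0 : (𝓜 s).E) R, Gc s i b * (1 + ((𝓜 s).t i).K' u) * Gc' s i b = 1 + Kg s i b u)
    (hmS : 0 < m - (cr + cc) / 2)
    (h0 : ∀ s (i : (𝓜 s).ι) b, ∀ j : ((𝓜 s).t i).Es b, ∀ z : ((𝓜 s).t i).Es b → ℂ,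
      m * nsq z ≤ (conjForm (compress (1 + K₀ s i) (((𝓜 s).t i).Es b)) κc (fun e : ((𝓜 s).t i).Es b => ds s i e j) z).re)
    (hSr : ∀ s (i : (𝓜 s).ι) b, ∀ u ∈ ball (0 : (𝓜 s).E) R, ∀ (j : ((𝓜 s).t i).Es b) (e : ((𝓜 s).t i).Es b),
      cRow (compress (Kg s i b u - K₀ s i) (((𝓜 s).t i).Es b)) κc (fun e : ((𝓜 s).t i).Es b => ds s i e j) e ≤ cr)
    (hSc : ∀ s (i : (𝓜 s).ι) b, ∀ u ∈ ball (0 : (𝓜 s).E) R, ∀ (j : ((𝓜 s).t i).Es b) (e' : ((𝓜 s).t i).Es b),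
      cCol (compress (Kg s i b u - K₀ s i) (((𝓜 s).t i).Es b)) κc (fun e : ((𝓜 s).t i).Es b => ds s i e j) e' ≤ cc)
    (hsite : ∀ s (i : (𝓜 s).ι) k, ∑ l, Real.exp (-(κc * ds s i k l)) ≤ cs)
    (hrow : ∀ s, RowSum (toB6 (torusGeom (𝓜 s).K 0 0 0) 0 True) μ cμ)
    (hfar : ∀ s (i : (𝓜 s).ι) (b : ((𝓜 s).t i).Λ), ∀ z ∈ ((𝓜 s).t i).X,
      Rσ₀ ≤ tdist1 (𝓜 s).K (((𝓜 s).t i).cubn (((𝓜 s).t i).rowOf b)) z)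
    (hκ₁ : 0 ≤ c.κ₁) (hCK : 0 ≤ CK) (hM : 0 < M) (hκc : 0 ≤ κc) (hcs : 0 ≤ cs) (hr₁ : 0 ≤ r₁)
    (hμ : 0 ≤ μ) (hμε : 3 * μ ≤ ε₀) (hμκ : 2 * μ < κ₀) (hwin : κ₀ + μ ≤ ρ₀ - ε₀) (hcμ : 0 ≤ cμ)
    (hq : cμ * (cμ * 1 *
      (1 * (((nC * (r₁ / M * CK) * (rg * rg' * (cs / (m - (cr + cc) / 2)))) * Real.exp (c.κ₁ * mJ) * Real.exp (2 * ρ₀ * r)) *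
        Real.exp (μ * r) * (nD * cμ))) * cμ) * cμ < 1)
    (hα : 0 ≤ α) (hαR : α < R)
    (hθ : 2 * max (cμ * (((rg * rg' * (cs / (m - (cr + cc) / 2))) * Real.exp (c.κ₁ * mJ) * Real.exp (2 * ρ₀ * r)) *
          Real.exp (μ * r) * (nD * cμ)) *
          (1 * (1 - cμ * (cμ * 1 *
            (1 * (((nC * (r₁ / M * CK) * (rg * rg' * (cs / (m - (cr + cc) / 2)))) * Real.exp (c.κ₁ * mJ) *
              Real.exp (2 * ρ₀ * r)) * Real.exp (μ * r) * (nD * cμ))) * cμ) * cμ)⁻¹) * cμ) 1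
        * (Real.exp (-((ε₀ - 3 * μ) * Rσ₀)) + α / R) ≤ θ₀) :
    ExistsUniformAcrossSmall (fun s => (𝓜 s).toTorusTerms c) α Rσ₀ θ₀ := by
  -- per-cube coercivity of the conjugated compression
  have hS : ∀ s (i : (𝓜 s).ι) b, ∀ u ∈ ball (0 : (𝓜 s).E) R, ∀ j : ((𝓜 s).t i).Es b, ∀ z : ((𝓜 s).t i).Es b → ℂ,
      (m - (cr + cc) / 2) * nsq z ≤ (conjForm (compress (Gc s i b * (1 + ((𝓜 s).t i).K' u) * Gc' s i b) (((𝓜 s).t i).Es b)) κc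
        (fun e : ((𝓜 s).t i).Es b => ds s i e j) z).re := by
    intro s i b
    refine gaugedCoercive_of_schur' (Ag := fun u => 1 + Kg s i b u) (1 + K₀ s i) (hcov s i b) (ds s i) (h0 s i b)
      (fun u hu j e => ?_) (fun u hu j e' => ?_)
    · have : (1 + Kg s i b u) - (1 + K₀ s i) = Kg s i b u - K₀ s i := by abel
      rw [this]; exact hSr s i b u hu j e
    · have : (1 + Kg s i b u) - (1 + K₀ s i) = Kg s i b u - K₀ s i := by abel
      rw [this]; exact hSc s i b u hu j e'
  have ha : ∀ s (i : (𝓜 s).ι) k l, DifferentiableOn ℂ (fun u => (1 + ((𝓜 s).t i).K' u) k l) (ball (0 : (𝓜 s).E) R) :=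
    fun s i k l => by simp only [Matrix.add_apply]; exact (differentiableOn_const _).add (hKan s i k l)
  exact acrossSmall_parametrix 𝓜 hanchor hdiam hJ hX hmult hsupp habs hE
    (fun s i b k l => by
      have e : (fun u => ((𝓜 s).t i).L.op b u k l) =
          fun u => extend (compress (1 + ((𝓜 s).t i).K' u) (((𝓜 s).t i).Es b))⁻¹ k l := funext fun u => by rw [hop]
      rw [e]
      exact differentiableOn_locInv_reducing (hGred s i b) (hG'red s i b) (hGG' s i b) (hG'G s i b) (ds s i) hmS (ha s i)
        (hS s i b) k l)
    (fun s i b u hu y y' => by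
      rw [hop s i b u]
      exact blockNorm_locInv_reducing_le ((𝓜 s).t i).cubn (hGred s i b) (hG'red s i b) (hGG' s i b) (hG'G s i b) (hGloc s i b)
        (hG'loc s i b) hrg0 hrg0' (hrg s i b) (hrg' s i b) (1 + ((𝓜 s).t i).K' u) (ds s i) (hd0 s i) hκc hmS (hS s i b u hu) hcs
        (hsite s i) y y')
    hKan
    (fun s i b u hu y y' => (blockNorm_comm_le ((𝓜 s).t i).cubn ((𝓜 s).t i).h (ds s i) hM hr₁ (hLip s i)
      (((𝓜 s).t i).K' u) (hKrange s i u) b y y').trans (mul_le_mul_of_nonneg_left (hKbd s i u hu y y') (div_nonneg hr₁ hM.le)))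
    (fun s i b u y y' hne => comm_blocks_subset ((𝓜 s).t i).cubn ((𝓜 s).t i).h ((𝓜 s).t i).Es (hsupp s i) (ds s i)
      (hsymm s i) (fun l => by rw [hd0 s i]; exact hr₁) (((𝓜 s).t i).K' u) (hKrange s i u) ((𝓜 s).t i).L.dom (hdomE s i)
      b y y' hne)
    hcard hrow hfar hκ₁ (mul_nonneg (mul_nonneg hrg0 hrg0') (div_nonneg hcs hmS.le)) (mul_nonneg (div_nonneg hr₁ hM.le) hCK)
    hμ hμε hμκ hwin hcμ hq hα hαR hθ

end Summit.QuantumFields.BalabanUV.Gaps.D4WalkModelGaugedSchur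

end
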